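import Summits.BirchSwinnertonDyer.BirchSwinnertonDyer.Theorems.ResidualThetaTransportAtTwoResidualSignedLambdaLowerCMAtTwoColemanPlusKernelTwoCoeff
import HarnessLib

/-!
# H1 (S146): `Col⁺ ⊗ 𝒪` at `p = 2` — existence, surjectivity and kernel FOR A HANDED plus Honda datum `(g, d)`
# (`colemanPlus_coeff_two` with the datum as BINDERS instead of `obtain`)

Route `ResidualThetaTransportAtTwo` (RTT), crux RSL_g `ResidualSignedLambdaLowerCMAtTwo` (stmt-BirchSwinnertonDyer-22608), line `onepair` v3f,
station (R) `stub_kzgValueRelation` of the KZ_g interior (stmt-BirchSwinnertonDyer-24105 hold-opening). Seat `bsd-wall-tp2-p2x-w2` g21 (width seat;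
`--supports`, closes nothing). THEOREMS ONLY (no definition, no named fact, no instance, no `sorry`); zero new mathematics: the landed proof of
`SignedColemanImage.colemanPlus_coeff_two` (…ColemanPlusKernelTwoCoeff, p-file) CUT at its line `have hND`, the two `obtain`s turned into binders
(stub-critic STUB-PLAN rev 27.1 §0.9 **S146**, k1-g23 PLAN B). BSD is not proved by any of this; RSL_g / KZ_g stay OPEN.

WHY. S143's road to station (R) reads Kato's values on THE DISPLAYED formal Honda datum `c` of
`SignedEC.PlusLayer.plusHondaSystemTwo_adicCompletion_withLog` (where (BKρ) and Kobayashi 8.25/8.26 are well-posed), so the plus Coleman map must be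
available for THAT datum, not for the anonymous one `colemanPlus_coeff_two` chooses: **`colemanPlus_coeff_two_of_datum`** takes a local lift `g` of the
topological generator and a family `d` with (L), (TR), (GEN), (GEN₀) (the four conjuncts of `plusHondaSystemTwo_adicCompletion`, VERBATIM) and returns
`hdA` together with the body of `colemanPlus_coeff_two` VERBATIM: `hg ∧ (L) ∧ (TR) ∧ (ND) ∧ ∀ 𝒪, (i) existence ∧ (ii) surjectivity ∧ (iii) kernel`.
The kernel clause (iii) is the SAME `signedLocalPoints κ _ W 1 n` clause as the pin `π.hcol_ker` (both are this proof's). `colemanPlus_coeff_two`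
is re-derived from it in three lines (`obtain ⟨g, hg⟩ := ZpExtension.IsCyclotomic.exists_isTopGenerator_resGalOfEmb_adicCompletion hκ v hv;
obtain ⟨d, hd, htr, hgen, hgen0⟩ := SignedEC.PlusLayer.plusHondaSystemTwo_adicCompletion W hss ha κ hκ v hv; obtain ⟨hdA, h⟩ :=
colemanPlus_coeff_two_of_datum W hss κ hκ v hv g hg d hd htr hgen hgen0; exact ⟨g, d, hdA, h⟩` — kernel-checked in the seat's folder, not restated
here: `dedup.landed`). The hypothesis `a₂(W) = 0` of the original is not needed once the datum is handed (it only served to produce `d`), so it is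
not a binder here.

References: [Kobayashi2003] Thm. 6.2 (6.13), Prop. 8.12, Prop. 8.18–8.23; [Sprung2012] Thm. 2.2 (2′), Prop. 7.3, Def. 5.9, Def. 7.9; [Sprung2017] Cor. 4.4.
-/

set_option autoImplicit false
-- the Theorems namespace of this sub repeats the summit name by design (D-0017 nested layout)
set_option linter.dupNamespace false

noncomputable section

open scoped Classical
open Polynomial Finset

namespace Summit.BirchSwinnertonDyer.BirchSwinnertonDyer.Theorems.SignedColemanImage

open Literature.NumberTheory.EllipticCurves Literature.NumberTheory.EllipticCurves.Sprung2017
  Literature.NumberTheory.EllipticCurves.Kobayashi2003 Summit.BirchSwinnertonDyer.Rank1Residual.Supersingular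

universe u

section Two

open NumberField IsDedekindDomain WeierstrassCurve Literature.NumberTheory.EllipticCurves.Rank1Residual

variable (W : WeierstrassCurve ℚ) [W.IsElliptic] [W.IsGloballyMinimal]

/-- **H1 — `Col⁺ ⊗ 𝒪` at `p = 2` for a HANDED plus Honda datum.** For `W/ℚ` globally minimal with `GoodSS W 2`, the cyclotomic `κ`, `v ∋ 2`, a
local lift `g` of the topological generator and a family `d` with (L) `d_m ∈ E(ℚ_{m,v})`, (TR) `Tr_{m+2/m+1} d_{m+2} = −d_m`, (GEN) and (GEN₀)
(the conjuncts of `SignedEC.PlusLayer.plusHondaSystemTwo_adicCompletion`, verbatim): the orbit `gʲ·d_m` lies in the tower points (`hdA`), (ND)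
`d_0 ∉ 2E(ℚ_v)`, and for EVERY `𝒪` finite free over `ℤ₂` and a domain: (i) every `𝒪`-valued functional `z` on `E(ℚ_{2,∞}·ℚ_v)` has a plus value
`L ∈ 𝒪⟦T⟧`; (ii) every `F ∈ 𝒪⟦T⟧` is such a value; (iii) a plus value of `z` is `0` iff `z` vanishes on every `E⁺(ℚ_{2,n}·ℚ_v)` — the body of
`colemanPlus_coeff_two` VERBATIM, for THIS datum. [cite: Kobayashi2003, Thm. 6.2 (6.13), Prop. 8.12, Prop. 8.18–8.23]
[cite: Sprung2012, Thm. 2.2 (2′), Prop. 7.3, Def. 5.9, Def. 7.9] [cite: Sprung2017, Cor. 4.4] -/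
theorem colemanPlus_coeff_two_of_datum (hss : GoodSS W 2) (κ : ZpExtension ℚ 2) (hκ : κ.IsCyclotomic)
    (v : HeightOneSpectrum (𝓞 ℚ)) (hv : (2 : 𝓞 ℚ) ∈ v.asIdeal)
    (g : Field.absoluteGaloisGroup (v.adicCompletion ℚ)) (hg : κ.IsTopGenerator (resGalOfEmb (closureEmb (K := ℚ) (v.adicCompletion ℚ)) g))
    (d : ℕ → localPoints W (v.adicCompletion ℚ))
    (hd : ∀ m, d m ∈ localLayerPointsOfEmb κ (closureEmb (K := ℚ) (v.adicCompletion ℚ)) W m)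
    (htr : ∀ m, localTraceOfEmb κ (closureEmb (K := ℚ) (v.adicCompletion ℚ)) W (m + 1) (m + 2) (d (m + 2)) = -d m)
    (hgen : ∀ m : ℕ, 1 ≤ m → ∀ P ∈ localLayerPointsOfEmb κ (closureEmb (K := ℚ) (v.adicCompletion ℚ)) W m,
      ∃ B ∈ AddSubgroup.closure (Set.range fun σ : Field.absoluteGaloisGroup (v.adicCompletion ℚ) ↦ σ • d m),
        ∃ P' ∈ localLayerPointsOfEmb κ (closureEmb (K := ℚ) (v.adicCompletion ℚ)) W (m - 1),
        ∃ R ∈ localLayerPointsOfEmb κ (closureEmb (K := ℚ) (v.adicCompletion ℚ)) W m, P = B + P' + 2 • R)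
    (hgen0 : ∀ P ∈ localLayerPointsOfEmb κ (closureEmb (K := ℚ) (v.adicCompletion ℚ)) W 0,
      ∃ a : ℤ, ∃ R ∈ localLayerPointsOfEmb κ (closureEmb (K := ℚ) (v.adicCompletion ℚ)) W 0, P = a • d 0 + 2 • R) :
    ∃ (hdA : ∀ m j, g ^ j • d m ∈ Sprung2012.localTowerPointsOfEmb κ (closureEmb (K := ℚ) (v.adicCompletion ℚ)) W),
      κ.IsTopGenerator (resGalOfEmb (closureEmb (K := ℚ) (v.adicCompletion ℚ)) g) ∧
      (∀ m, d m ∈ localLayerPointsOfEmb κ (closureEmb (K := ℚ) (v.adicCompletion ℚ)) W m) ∧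
      (∀ m, localTraceOfEmb κ (closureEmb (K := ℚ) (v.adicCompletion ℚ)) W (m + 1) (m + 2) (d (m + 2)) = -d m) ∧
      (∀ b ∈ localLayerPointsOfEmb κ (closureEmb (K := ℚ) (v.adicCompletion ℚ)) W 0, d 0 ≠ 2 • b) ∧
      ∀ (O : Type) [CommRing O] [IsDomain O] [Algebra ℤ_[2] O] [Module.Free ℤ_[2] O] [Module.Finite ℤ_[2] O],
        (∀ z : Sprung2012.localTowerPointsOfEmb κ (closureEmb (K := ℚ) (v.adicCompletion ℚ)) W →+ O, ∃ L : PowerSeries O, ∀ m : ℕ,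
          (((cyclotomicOmega 2 (2 * m)).map (Int.castRingHom O) : O[X]) : PowerSeries O) ∣
            ((∑ j ∈ range (2 ^ (2 * m)), C (z ⟨g ^ j • d (2 * m), hdA (2 * m) j⟩) * (X + 1) ^ j : O[X]) : PowerSeries O) +
              (-1 : PowerSeries O) ^ m * (((cyclotomicOmegaMinus 2 (2 * m)).map (Int.castRingHom O) : O[X]) : PowerSeries O) * L) ∧
        (∀ F : PowerSeries O, ∃ z : Sprung2012.localTowerPointsOfEmb κ (closureEmb (K := ℚ) (v.adicCompletion ℚ)) W →+ O, ∀ m : ℕ,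
          (((cyclotomicOmega 2 (2 * m)).map (Int.castRingHom O) : O[X]) : PowerSeries O) ∣
            ((∑ j ∈ range (2 ^ (2 * m)), C (z ⟨g ^ j • d (2 * m), hdA (2 * m) j⟩) * (X + 1) ^ j : O[X]) : PowerSeries O) +
              (-1 : PowerSeries O) ^ m * (((cyclotomicOmegaMinus 2 (2 * m)).map (Int.castRingHom O) : O[X]) : PowerSeries O) * F) ∧
        (∀ (z : Sprung2012.localTowerPointsOfEmb κ (closureEmb (K := ℚ) (v.adicCompletion ℚ)) W →+ O) (L : PowerSeries O),
          (∀ m : ℕ, (((cyclotomicOmega 2 (2 * m)).map (Int.castRingHom O) : O[X]) : PowerSeries O) ∣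
            ((∑ j ∈ range (2 ^ (2 * m)), C (z ⟨g ^ j • d (2 * m), hdA (2 * m) j⟩) * (X + 1) ^ j : O[X]) : PowerSeries O) +
              (-1 : PowerSeries O) ^ m * (((cyclotomicOmegaMinus 2 (2 * m)).map (Int.castRingHom O) : O[X]) : PowerSeries O) * L) →
          (L = 0 ↔ ∀ (n : ℕ) (x : localPoints W (v.adicCompletion ℚ))
            (hx : x ∈ signedLocalPoints κ (v.adicCompletion ℚ) W 1 n),
            z ⟨x, Sprung2012.localLayerPointsOfEmb_le_localTowerPointsOfEmb κ _ W n (signedLocalPointsOfEmb_le κ _ W 1 n hx)⟩ = 0)) := by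
  set ι := closureEmb (K := ℚ) (v.adicCompletion ℚ) with hι
  -- (ND) from (GEN₀) and LEV0@2
  have hND : ∀ b ∈ localLayerPointsOfEmb κ ι W 0, d 0 ≠ 2 • b := by
    obtain ⟨m₀, hm₀, hne⟩ := SignedEC.exists_mem_localLayerPointsOfEmb_zero_ne_two_nsmul W κ v hv
    intro b hb hdb
    obtain ⟨c, R, hR, hm₀eq⟩ := hgen0 m₀ hm₀
    refine hne (c • b + R) (AddSubgroup.add_mem _ (AddSubgroup.zsmul_mem _ hb c) hR) ?_
    rw [hm₀eq, hdb, smul_add, smul_comm]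
  have hdA : ∀ m j, g ^ j • d m ∈ Sprung2012.localTowerPointsOfEmb κ ι W := fun m j ↦
    Sprung2012.smul_mem_localTowerPointsOfEmb κ ι W _ (Sprung2012.localLayerPointsOfEmb_le_localTowerPointsOfEmb κ ι W m (hd m))
  have hnt : ∀ P ∈ Sprung2012.localTowerPointsOfEmb κ ι W, 2 • P = 0 → P = 0 := fun P hP h2 ↦
    SSFlatEC.eq_zero_of_mem_localTowerPointsOfEmb_of_two_nsmul W hss κ hv _ hP h2
  have hidx : ∀ m : ℕ, ((localLayerSubgroupOfEmb κ ι (m + 1)).subgroupOf (localLayerSubgroupOfEmb κ ι m)).index = 2 :=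
    SignedEC.index_subgroupOf_localLayerSubgroupOfEmb_succ_eq hκ v hv
  refine ⟨hdA, hg, hd, htr, hND, fun O _ _ _ _ _ ↦ ⟨fun z ↦ ?_, fun F ↦ ?_, fun z L hcong ↦ ⟨fun hL ↦ ?_, fun hz ↦ ?_⟩⟩⟩
  · -- (i) existence: `…PairingSumPlusValueCoeff.exists_plusValue_addMonoidHom_coeff` (sign flipped)
    have hfix : ∀ n, g ^ 2 ^ n • d n = d n := fun n ↦ by
      simpa using Sprung2012.pow_mul_smul_of_mem_localLayerPointsOfEmb κ ι W hg (hd n) 1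
    have htr' : ∀ n, ∑ s ∈ range 2, g ^ (2 ^ (n + 1) * s) • d (n + 2) = -d n := fun n ↦ by
      rw [← Sprung2012.localTraceOfEmb_succ_eq_sum_pow_smul κ ι W hg (n + 1) (hd (n + 2))]
      exact htr n
    obtain ⟨L, hL⟩ := exists_plusValue_addMonoidHom_coeff W (Sprung2012.localTowerPointsOfEmb κ ι W) g d hdA hfix htr' z
    refine ⟨-L, fun m ↦ ?_⟩
    have h := hL m
    convert h using 2
    ring
  · -- (ii) onto: a unit functional at `d_0`, then `exists_isColemanPair_flat_eq_of_isUnit`, coordinatewise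
    obtain ⟨z₀, hz₀⟩ := exists_addMonoidHom_isUnit_two W hss κ v hv d hd hND
    have honto' : ∀ a : PowerSeries ℤ_[2], ∃ z : Sprung2012.localTowerPointsOfEmb κ ι W →+ ℤ_[2], ∀ m : ℕ,
        (((cyclotomicOmega 2 (2 * m)).map (Int.castRingHom ℤ_[2]) : ℤ_[2][X]) : PowerSeries ℤ_[2]) ∣
          ((∑ j ∈ range (2 ^ (2 * m)), C (z ⟨g ^ j • d (2 * m), hdA (2 * m) j⟩) * (X + 1) ^ j : ℤ_[2][X]) : PowerSeries ℤ_[2]) +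
            (((-1 : ℤ) ^ m : ℤ) : PowerSeries ℤ_[2]) *
              (((cyclotomicOmegaMinus 2 (2 * m)).map (Int.castRingHom ℤ_[2]) : ℤ_[2][X]) : PowerSeries ℤ_[2]) * a := by
      intro a
      obtain ⟨z, Ls, hz⟩ := exists_isColemanPair_flat_eq_of_isUnit κ ι W hg d hd htr z₀ hz₀ a
      refine ⟨z, fun m ↦ ?_⟩
      have h := hz (2 * m)
      rw [sharpPoly_zero_of_even 2 (even_two_mul m), flatPoly_zero_of_even 2 (even_two_mul m),
        show 2 * m / 2 = m by omega, map_zero, zero_mul, zero_add, toIwasawa_apply, toIwasawa_apply,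
        pairingSum_eq_coe_orbitSum, Polynomial.map_mul, Polynomial.map_pow, Polynomial.map_neg, Polynomial.map_one,
        Polynomial.coe_mul, Polynomial.coe_pow, Polynomial.coe_neg, Polynomial.coe_one] at h
      rw [Finset.sum_congr rfl fun j _ ↦ by rw [Sprung2012.evalOn_of_mem W _ z (hdA (2 * m) j)]] at h
      convert h using 2
      push_cast
      ring
    obtain ⟨z, hz⟩ := exists_addMonoidHom_coeff_of_forall_exists (O := O)
      (fun m j ↦ (⟨g ^ j • d (2 * m), hdA (2 * m) j⟩ : Sprung2012.localTowerPointsOfEmb κ ι W)) (fun m ↦ 2 ^ (2 * m))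
      (fun m ↦ cyclotomicOmega 2 (2 * m)) (fun m ↦ cyclotomicOmegaMinus 2 (2 * m)) (fun m ↦ (-1) ^ m) honto' F
    refine ⟨z, fun m ↦ ?_⟩
    have h := hz m
    push_cast at h
    exact h
  · -- (iii, ⇒) value `0` ⇒ kills `E⁺`
    subst hL
    intro n x hx
    refine forall_signedPlus_eq_zero_of_plusCongr_zero hnt hidx hg hd htr hgen hgen0 hdA z (fun m ↦ ?_) n x hx
    simpa using hcong m
  · -- (iii, ⇐) kills `E⁺` ⇒ value `0`
    exact eq_zero_of_plusCongr_of_forall_signedPlus hd htr hdA z L hcong hz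

end Two

end Summit.BirchSwinnertonDyer.BirchSwinnertonDyer.Theorems.SignedColemanImage

end
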